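import Summits.AtomisticToContinuum.BoseEinsteinCondensation.Theorems.BECHeatBathGapJastrowDobrushinRungSymmetry

/-!
# Route `BECHeatBathGap` — support item `JastrowDobrushinRung` (stmt-AtomisticToContinuum-14373):
# oscillation calculus, Dobrushin's lemma and the contraction of the Gibbs sampler (helper file 3)

Helpers for the proof of
`Summit.AtomisticToContinuum.BoseEinsteinCondensation.Theses.BECHeatBathGap.JastrowDobrushinRung`
(approximate tensorisation of variance with constant 2 for the Jastrow law under
`5N∫(1-f²) ≤ L³`, via Dobrushin uniqueness ⇒ heat-bath spectral gap ≥ 1 - r, Wu 2006, re-proved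
from scratch). As in helper file 1, the operators `S` (one-site average), `T` (heat bath),
`P = N⁻¹∑T_j` (random-scan Gibbs sampler) and the weights `w = B_j π_j` are variables with
defining hypotheses `hS, hT, hP, hw, …` (no auxiliary definitions).

This file: the path lemma (`abs_sub_le_sum_osc`), the sup bound for `w`-mean-zero functions,
Dobrushin's comparison lemma `osc_T` (oscillation of `T_j F` in `x_k` is at most `d_k + c d_j`),
and for `P = N⁻¹ ∑_j T_j`: measurability, bounds, mean preservation and the oscillation
contraction `osc_iterate_P` (total oscillation of `PⁿF` ≤ `ρⁿ` × that of `F`,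
`ρ = (N-1)(1+c)/N`).
-/

noncomputable section

namespace Summit.AtomisticToContinuum.BoseEinsteinCondensation.Theorems

namespace JastrowDobrushin

open MeasureTheory Function
open scoped ENNReal

variable {ι : Type*} [DecidableEq ι] {E : Type*} [MeasurableSpace E]
  {u : Measure E} {S : ι → ((ι → E) → ℝ) → (ι → E) → ℝ}
variable {π : ι → (ι → E) → ℝ} {T : ι → ((ι → E) → ℝ) → (ι → E) → ℝ}
variable {w : (ι → E) → ℝ} {B : ι → (ι → E) → ℝ}

/-! ### Oscillation calculus and Dobrushin's comparison lemma -/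

omit [MeasurableSpace E] in
/-- **Path lemma**: a function whose oscillation in coordinate `k` is at most `e k` varies by at
most `∑ e` between any two configurations (change the coordinates one at a time). [folklore] -/
theorem abs_sub_le_sum_osc [Fintype ι] {G : (ι → E) → ℝ} {e : ι → ℝ}
    (hG : ∀ k X y y', |G (update X k y) - G (update X k y')| ≤ e k) (X Y : ι → E) :
    |G X - G Y| ≤ ∑ k, e k := by
  suffices h : ∀ s : Finset ι, ∀ X Y : ι → E, (∀ i, i ∉ s → X i = Y i) →
      |G X - G Y| ≤ ∑ k ∈ s, e k from h Finset.univ X Y fun i hi => absurd (Finset.mem_univ i) hi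
  intro s
  induction s using Finset.induction_on with
  | empty =>
    intro X Y hXY
    have : X = Y := funext fun i => hXY i (Finset.notMem_empty i)
    simp [this]
  | insert k s hk ih =>
    intro X Y hXY
    have h1 : |G X - G (update X k (Y k))| ≤ e k := by
      have := hG k X (X k) (Y k)
      rwa [update_eq_self] at this
    have h2 : |G (update X k (Y k)) - G Y| ≤ ∑ k ∈ s, e k := by
      refine ih _ _ fun i hi => ?_
      by_cases hik : i = k
      · subst hik; simp
      · rw [update_of_ne hik]
        exact hXY i (by simp [hik, hi])
    calc |G X - G Y| = |(G X - G (update X k (Y k))) + (G (update X k (Y k)) - G Y)| := by ring_nf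
      _ ≤ |G X - G (update X k (Y k))| + |G (update X k (Y k)) - G Y| := abs_add_le _ _
      _ ≤ e k + ∑ k ∈ s, e k := add_le_add h1 h2
      _ = ∑ k ∈ insert k s, e k := (Finset.sum_insert hk).symm

/-- A `w`-mean-zero function is bounded pointwise by its total oscillation (`∫ w > 0`).
[folklore] -/
theorem abs_le_sum_osc_of_integral_eq_zero [Fintype ι] {μ : Measure (ι → E)} [IsFiniteMeasure μ]
    {G : (ι → E) → ℝ} (hGm : Measurable G) {C : ℝ} (hGb : ∀ X, |G X| ≤ C)
    (hwm : Measurable w) (hw1 : ∀ X, 0 ≤ w X ∧ w X ≤ 1) (hpos : 0 < ∫ X, w X ∂μ)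
    (h0 : ∫ X, G X * w X ∂μ = 0) {e : ι → ℝ}
    (hG : ∀ k X y y', |G (update X k y) - G (update X k y')| ≤ e k) (X : ι → E) :
    |G X| ≤ ∑ k, e k := by
  have hiw : Integrable w μ := integrable_of_bounded hwm (C := 1) fun Y => by
    rw [abs_of_nonneg (hw1 Y).1]; exact (hw1 Y).2
  have hiGw : Integrable (fun Y => G Y * w Y) μ := integrable_mul_w hGm hGb hwm hw1
  have key : G X * ∫ Y, w Y ∂μ = ∫ Y, (G X - G Y) * w Y ∂μ := by
    have : (fun Y => (G X - G Y) * w Y) = fun Y => G X * w Y - G Y * w Y := by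
      funext Y; ring
    rw [this, integral_sub (hiw.const_mul _) hiGw, integral_const_mul, h0, sub_zero]
  have hle : |G X| * ∫ Y, w Y ∂μ ≤ (∑ k, e k) * ∫ Y, w Y ∂μ := by
    rw [← abs_of_pos hpos, ← abs_mul, key, abs_of_pos hpos, ← integral_const_mul]
    refine (abs_integral_le_integral_abs).trans (integral_mono_of_nonneg (ae_of_all _ fun Y => ?_)
      ((hiw.const_mul _)) (ae_of_all _ fun Y => ?_))
    · exact abs_nonneg _
    · simp only
      rw [abs_mul, abs_of_nonneg (hw1 Y).1]
      exact mul_le_mul_of_nonneg_right (abs_sub_le_sum_osc hG X Y) (hw1 Y).1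
  exact le_of_mul_le_mul_right hle hpos

/-- The heat-bath operator `T_j` kills the oscillation in coordinate `j`. [folklore] -/
theorem osc_T_self (hS : ∀ j G X, S j G X = ∫ y, G (update X j y) ∂u)
    (hT : ∀ j F X, T j F X = S j (fun Y => F Y * π j Y) X / S j (π j) X) (j : ι)
    (F : (ι → E) → ℝ) (X : ι → E) (y y' : E) :
    |T j F (update X j y) - T j F (update X j y')| ≤ 0 := by
  rw [T_update hS hT, T_update hS hT, sub_self, abs_zero]

/-- **Dobrushin's comparison lemma.** If the one-site conditional law at `j` moves by at most
`c` in total variation when the coordinate `k ≠ j` is changed (hypothesis `hD`, tested on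
functions of `x_j` of oscillation `δ`), then for `F` with oscillations `d_k` (in `x_k`) and
`d_j` (in `x_j`), the oscillation of `T_j F` in `x_k` is at most `d_k + c d_j`.
[folklore] -/
theorem osc_T [IsProbabilityMeasure u] (hS : ∀ j G X, S j G X = ∫ y, G (update X j y) ∂u)
    (hT : ∀ j F X, T j F X = S j (fun Y => F Y * π j Y) X / S j (π j) X)
    (hπ : ∀ j, Measurable (π j) ∧ ∀ X, 0 ≤ π j X ∧ π j X ≤ 1) (hZ : ∀ j X, 0 < S j (π j) X)
    {j k : ι} (hjk : j ≠ k) {c : ℝ}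
    (hD : ∀ (X : ι → E) (y y' : E) (φ : E → ℝ) (Cφ δ : ℝ), Measurable φ → (∀ z, |φ z| ≤ Cφ) →
      (∀ z z', |φ z - φ z'| ≤ δ) →
      |T j (fun Y => φ (Y j)) (update X k y) - T j (fun Y => φ (Y j)) (update X k y')| ≤ c * δ)
    {F : (ι → E) → ℝ} (hFm : Measurable F) {C : ℝ} (hFb : ∀ X, |F X| ≤ C) {dk dj : ℝ}
    (hdk : ∀ X y y', |F (update X k y) - F (update X k y')| ≤ dk)
    (hdj : ∀ X y y', |F (update X j y) - F (update X j y')| ≤ dj) (X : ι → E) (y y' : E) :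
    |T j F (update X k y) - T j F (update X k y')| ≤ dk + c * dj := by
  -- `F'` = `F` with `x_k` frozen at `y'`; `φ` = the section of `F` at `X'' = X[k ↦ y']`
  set F' : (ι → E) → ℝ := fun Y => F (update Y k y') with hF'
  set φ : E → ℝ := fun z => F (update (update X k y') j z) with hφ
  have hF'm : Measurable F' := hFm.comp measurable_update_left
  have hF'b : ∀ Y, |F' Y| ≤ C := fun Y => hFb _
  have hφm : Measurable φ := hFm.comp (measurable_update _)
  -- (a) `T_j F X' - T_j F' X' = T_j (F - F') X'`, bounded by `dk`
  have ha : |T j F (update X k y) - T j F' (update X k y)| ≤ dk := by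
    rw [← T_sub hS hT hπ j hFm hF'm hFb hF'b]
    refine abs_T_le hS hT hπ hZ j (hFm.sub hF'm) (fun Y => ?_) _
    have := hdk Y (Y k) y'
    rwa [update_eq_self] at this
  -- (b) `T_j F' X' = T_j (φ ∘ eval j) X'`
  have hb : T j F' (update X k y) = T j (fun Y => φ (Y j)) (update X k y) := by
    refine T_congr hS hT fun z => ?_
    simp only [hF', hφ, update_self]
    rw [update_comm hjk.symm, update_idem, update_comm hjk]
  -- (c) `T_j F X'' = T_j (φ ∘ eval j) X''`
  have hc : T j F (update X k y') = T j (fun Y => φ (Y j)) (update X k y') := by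
    refine T_congr hS hT fun z => ?_
    simp only [hφ, update_self]
  -- (d) Dobrushin hypothesis
  have hd : |T j (fun Y => φ (Y j)) (update X k y) - T j (fun Y => φ (Y j)) (update X k y')|
      ≤ c * dj :=
    hD X y y' φ C dj hφm (fun z => hFb _) fun z z' => hdj _ z z'
  calc |T j F (update X k y) - T j F (update X k y')|
      = |(T j F (update X k y) - T j F' (update X k y)) +
          (T j (fun Y => φ (Y j)) (update X k y) - T j (fun Y => φ (Y j)) (update X k y'))| := by
        rw [hb, hc]; ring_nf
    _ ≤ dk + c * dj := (abs_add_le _ _).trans (add_le_add ha hd)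


/-! ### The random-scan Gibbs sampler `P = N⁻¹ ∑_j T_j`: oscillation contraction -/

variable {P : ((ι → E) → ℝ) → (ι → E) → ℝ}

omit [MeasurableSpace E] in
/-- Row/column bookkeeping: `∑_k ∑_{j ≠ k} (d_k + c d_j) = (N-1)(1+c) ∑_k d_k`. [folklore] -/
theorem sum_sum_ite_eq [Fintype ι] (d : ι → ℝ) (c : ℝ) :
    ∑ k, ∑ j, (if j = k then (0 : ℝ) else d k + c * d j) =
      ((Fintype.card ι : ℝ) - 1) * (1 + c) * ∑ k, d k := by
  have h : ∀ k, ∑ j, (if j = k then (0 : ℝ) else d k + c * d j) =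
      (Fintype.card ι : ℝ) * d k + c * ∑ j, d j - (1 + c) * d k := by
    intro k
    have h1 : ∀ j, (if j = k then (0 : ℝ) else d k + c * d j) =
        (d k + c * d j) - (if j = k then d k + c * d j else 0) := fun j => by
      split_ifs <;> ring
    simp_rw [h1]
    rw [Finset.sum_sub_distrib, Finset.sum_ite_eq' Finset.univ k, if_pos (Finset.mem_univ k),
      Finset.sum_add_distrib, Finset.sum_const, Finset.card_univ, ← Finset.mul_sum, nsmul_eq_mul]
    ring
  simp_rw [h]
  simp only [Finset.sum_sub_distrib, Finset.sum_add_distrib, ← Finset.mul_sum, Finset.sum_const,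
    Finset.card_univ, nsmul_eq_mul]
  ring

/-- `P F` is measurable. [folklore] -/
theorem measurable_P [Fintype ι] [SFinite u]
    (hS : ∀ j G X, S j G X = ∫ y, G (update X j y) ∂u)
    (hT : ∀ j F X, T j F X = S j (fun Y => F Y * π j Y) X / S j (π j) X)
    (hπ : ∀ j, Measurable (π j) ∧ ∀ X, 0 ≤ π j X ∧ π j X ≤ 1)
    (hP : ∀ F X, P F X = (Fintype.card ι : ℝ)⁻¹ * ∑ j, T j F X)
    {F : (ι → E) → ℝ} (hFm : Measurable F) : Measurable (P F) := by
  have h : P F = fun X => (Fintype.card ι : ℝ)⁻¹ * ∑ j, T j F X := funext (hP F)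
  rw [h]
  exact (Finset.measurable_sum _ fun j _ => measurable_T hS hT hπ j hFm).const_mul _

/-- `|P F| ≤ C` if `|F| ≤ C`. [folklore] -/
theorem abs_P_le [Fintype ι] [IsProbabilityMeasure u]
    (hS : ∀ j G X, S j G X = ∫ y, G (update X j y) ∂u)
    (hT : ∀ j F X, T j F X = S j (fun Y => F Y * π j Y) X / S j (π j) X)
    (hπ : ∀ j, Measurable (π j) ∧ ∀ X, 0 ≤ π j X ∧ π j X ≤ 1) (hZ : ∀ j X, 0 < S j (π j) X)
    (hP : ∀ F X, P F X = (Fintype.card ι : ℝ)⁻¹ * ∑ j, T j F X)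
    {F : (ι → E) → ℝ} (hFm : Measurable F) {C : ℝ} (hFb : ∀ X, |F X| ≤ C) (X : ι → E) :
    |P F X| ≤ C := by
  have hC : 0 ≤ C := (abs_nonneg _).trans (hFb X)
  rw [hP, abs_mul, abs_of_nonneg (by positivity)]
  calc (Fintype.card ι : ℝ)⁻¹ * |∑ j, T j F X|
      ≤ (Fintype.card ι : ℝ)⁻¹ * ∑ _j : ι, C := by
        refine mul_le_mul_of_nonneg_left ((Finset.abs_sum_le_sum_abs _ _).trans
          (Finset.sum_le_sum fun j _ => abs_T_le hS hT hπ hZ j hFm hFb X)) (by positivity)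
    _ ≤ C := by
        rw [Finset.sum_const, Finset.card_univ, nsmul_eq_mul]
        rcases eq_or_ne (Fintype.card ι : ℝ) 0 with h | h
        · rw [h]; simpa using hC
        · rw [inv_mul_cancel_left₀ h]

/-- `P` preserves the `w`-mean. [folklore] -/
theorem integral_P_mul_w [Fintype ι] [Nonempty ι] [IsProbabilityMeasure u]
    (hS : ∀ j G X, S j G X = ∫ y, G (update X j y) ∂u)
    (hT : ∀ j F X, T j F X = S j (fun Y => F Y * π j Y) X / S j (π j) X)
    (hπ : ∀ j, Measurable (π j) ∧ ∀ X, 0 ≤ π j X ∧ π j X ≤ 1) (hZ : ∀ j X, 0 < S j (π j) X)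
    (hw : ∀ j X, w X = B j X * π j X)
    (hB : ∀ j, Measurable (B j) ∧ (∀ X, 0 ≤ B j X ∧ B j X ≤ 1) ∧ ∀ X y, B j (update X j y) = B j X)
    (hP : ∀ F X, P F X = (Fintype.card ι : ℝ)⁻¹ * ∑ j, T j F X)
    {F : (ι → E) → ℝ} (hFm : Measurable F) {C : ℝ} (hFb : ∀ X, |F X| ≤ C) :
    ∫ X, P F X * w X ∂(Measure.pi fun _ : ι => u) = ∫ X, F X * w X ∂(Measure.pi fun _ : ι => u) := by
  have j₀ : ι := Classical.arbitrary ι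
  have hwm := measurable_w hπ hw hB j₀
  have hw1 := w_mem hπ hw hB j₀
  have h1 : (fun X => P F X * w X) = fun X => ∑ j, (Fintype.card ι : ℝ)⁻¹ * (T j F X * w X) := by
    funext X; rw [hP, Finset.mul_sum, Finset.sum_mul]; simp only [mul_assoc]
  rw [h1, integral_finsetSum _ fun j _ => ((integrable_mul_w (measurable_T hS hT hπ j hFm)
    (abs_T_le hS hT hπ hZ j hFm hFb) hwm hw1).const_mul _)]
  simp_rw [integral_const_mul, integral_T_mul_w hS hT hπ hZ hw hB _ hFm hFb]
  rw [Finset.sum_const, Finset.card_univ, nsmul_eq_mul, ← mul_assoc,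
    mul_inv_cancel₀ (Nat.cast_ne_zero.mpr Fintype.card_ne_zero), one_mul]

/-- **One step of the oscillation contraction.** If `F` has oscillations `d_k` and the Dobrushin
hypothesis holds with constant `c` for every pair `j ≠ k`, then `P F` has oscillation at most
`N⁻¹ ∑_{j ≠ k} (d_k + c d_j)` in `x_k`. [folklore] -/
theorem osc_P [Fintype ι] [IsProbabilityMeasure u]
    (hS : ∀ j G X, S j G X = ∫ y, G (update X j y) ∂u)
    (hT : ∀ j F X, T j F X = S j (fun Y => F Y * π j Y) X / S j (π j) X)
    (hπ : ∀ j, Measurable (π j) ∧ ∀ X, 0 ≤ π j X ∧ π j X ≤ 1) (hZ : ∀ j X, 0 < S j (π j) X)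
    (hP : ∀ F X, P F X = (Fintype.card ι : ℝ)⁻¹ * ∑ j, T j F X) {c : ℝ}
    (hD : ∀ j k, j ≠ k → ∀ (X : ι → E) (y y' : E) (φ : E → ℝ) (Cφ δ : ℝ), Measurable φ →
      (∀ z, |φ z| ≤ Cφ) → (∀ z z', |φ z - φ z'| ≤ δ) →
      |T j (fun Y => φ (Y j)) (update X k y) - T j (fun Y => φ (Y j)) (update X k y')| ≤ c * δ)
    {F : (ι → E) → ℝ} (hFm : Measurable F) {C : ℝ} (hFb : ∀ X, |F X| ≤ C) {d : ι → ℝ}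
    (hd : ∀ k X y y', |F (update X k y) - F (update X k y')| ≤ d k) (k : ι) (X : ι → E)
    (y y' : E) :
    |P F (update X k y) - P F (update X k y')| ≤
      (Fintype.card ι : ℝ)⁻¹ * ∑ j, (if j = k then (0 : ℝ) else d k + c * d j) := by
  rw [hP, hP, ← mul_sub, abs_mul, abs_of_nonneg (by positivity), ← Finset.sum_sub_distrib]
  refine mul_le_mul_of_nonneg_left ((Finset.abs_sum_le_sum_abs _ _).trans
    (Finset.sum_le_sum fun j _ => ?_)) (by positivity)
  by_cases hj : j = k
  · subst hj; rw [if_pos rfl]; exact osc_T_self hS hT j F X y y'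
  · rw [if_neg hj]; exact osc_T hS hT hπ hZ hj (hD j k hj) hFm hFb (hd k) (hd j) X y y'

/-- Measurability of the iterates `P^[n] F`. [folklore] -/
theorem measurable_iterate_P [Fintype ι] [SFinite u]
    (hS : ∀ j G X, S j G X = ∫ y, G (update X j y) ∂u)
    (hT : ∀ j F X, T j F X = S j (fun Y => F Y * π j Y) X / S j (π j) X)
    (hπ : ∀ j, Measurable (π j) ∧ ∀ X, 0 ≤ π j X ∧ π j X ≤ 1)
    (hP : ∀ F X, P F X = (Fintype.card ι : ℝ)⁻¹ * ∑ j, T j F X) (n : ℕ) :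
    ∀ {F : (ι → E) → ℝ}, Measurable F → Measurable (P^[n] F) := by
  induction n with
  | zero => intro F hF; simpa using hF
  | succ n ih =>
    intro F hF
    rw [Function.iterate_succ_apply']
    exact measurable_P hS hT hπ hP (ih hF)

/-- Boundedness of the iterates `P^[n] F`. [folklore] -/
theorem abs_iterate_P_le [Fintype ι] [IsProbabilityMeasure u]
    (hS : ∀ j G X, S j G X = ∫ y, G (update X j y) ∂u)
    (hT : ∀ j F X, T j F X = S j (fun Y => F Y * π j Y) X / S j (π j) X)
    (hπ : ∀ j, Measurable (π j) ∧ ∀ X, 0 ≤ π j X ∧ π j X ≤ 1) (hZ : ∀ j X, 0 < S j (π j) X)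
    (hP : ∀ F X, P F X = (Fintype.card ι : ℝ)⁻¹ * ∑ j, T j F X) {C : ℝ} (n : ℕ) :
    ∀ {F : (ι → E) → ℝ}, Measurable F → (∀ X, |F X| ≤ C) → ∀ X, |(P^[n] F) X| ≤ C := by
  induction n with
  | zero => intro F _ hFb X; simpa using hFb X
  | succ n ih =>
    intro F hF hFb X
    rw [Function.iterate_succ_apply']
    exact abs_P_le hS hT hπ hZ hP (measurable_iterate_P hS hT hπ hP n hF) (ih hF hFb) X

/-- The iterates `P^[n] F` have the same `w`-mean as `F`. [folklore] -/
theorem integral_iterate_P_mul_w [Fintype ι] [Nonempty ι] [IsProbabilityMeasure u]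
    (hS : ∀ j G X, S j G X = ∫ y, G (update X j y) ∂u)
    (hT : ∀ j F X, T j F X = S j (fun Y => F Y * π j Y) X / S j (π j) X)
    (hπ : ∀ j, Measurable (π j) ∧ ∀ X, 0 ≤ π j X ∧ π j X ≤ 1) (hZ : ∀ j X, 0 < S j (π j) X)
    (hw : ∀ j X, w X = B j X * π j X)
    (hB : ∀ j, Measurable (B j) ∧ (∀ X, 0 ≤ B j X ∧ B j X ≤ 1) ∧ ∀ X y, B j (update X j y) = B j X)
    (hP : ∀ F X, P F X = (Fintype.card ι : ℝ)⁻¹ * ∑ j, T j F X) {C : ℝ} (n : ℕ) :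
    ∀ {F : (ι → E) → ℝ}, Measurable F → (∀ X, |F X| ≤ C) →
      ∫ X, (P^[n] F) X * w X ∂(Measure.pi fun _ : ι => u) =
        ∫ X, F X * w X ∂(Measure.pi fun _ : ι => u) := by
  induction n with
  | zero => intro F _ _; simp
  | succ n ih =>
    intro F hF hFb
    rw [Function.iterate_succ_apply',
      integral_P_mul_w hS hT hπ hZ hw hB hP (measurable_iterate_P hS hT hπ hP n hF)
        (abs_iterate_P_le hS hT hπ hZ hP n hF hFb)]
    exact ih hF hFb

/-- **Oscillation contraction of the Gibbs sampler under Dobrushin's condition**: the total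
oscillation of `P^[n] F` is at most `ρ^n` times that of `F`, `ρ = (N-1)(1+c)/N = 1 - (1-r)/N`
with `r = (N-1)c` the Dobrushin row sum. [folklore] -/
theorem osc_iterate_P [Fintype ι] [IsProbabilityMeasure u]
    (hS : ∀ j G X, S j G X = ∫ y, G (update X j y) ∂u)
    (hT : ∀ j F X, T j F X = S j (fun Y => F Y * π j Y) X / S j (π j) X)
    (hπ : ∀ j, Measurable (π j) ∧ ∀ X, 0 ≤ π j X ∧ π j X ≤ 1) (hZ : ∀ j X, 0 < S j (π j) X)
    (hP : ∀ F X, P F X = (Fintype.card ι : ℝ)⁻¹ * ∑ j, T j F X) {c : ℝ} (hc : 0 ≤ c)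
    (hD : ∀ j k, j ≠ k → ∀ (X : ι → E) (y y' : E) (φ : E → ℝ) (Cφ δ : ℝ), Measurable φ →
      (∀ z, |φ z| ≤ Cφ) → (∀ z z', |φ z - φ z'| ≤ δ) →
      |T j (fun Y => φ (Y j)) (update X k y) - T j (fun Y => φ (Y j)) (update X k y')| ≤ c * δ)
    {C : ℝ} (n : ℕ) :
    ∀ {F : (ι → E) → ℝ}, Measurable F → (∀ X, |F X| ≤ C) → ∀ {d : ι → ℝ},
      (∀ k X y y', |F (update X k y) - F (update X k y')| ≤ d k) →
      ∃ d' : ι → ℝ, (∀ k X y y', |(P^[n] F) (update X k y) - (P^[n] F) (update X k y')| ≤ d' k) ∧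
        ∑ k, d' k ≤ (((Fintype.card ι : ℝ) - 1) * (1 + c) / (Fintype.card ι : ℝ)) ^ n *
          ∑ k, d k := by
  have hρ : 0 ≤ ((Fintype.card ι : ℝ) - 1) * (1 + c) / (Fintype.card ι : ℝ) := by
    rcases Nat.eq_zero_or_pos (Fintype.card ι) with h | h
    · simp [h]
    · have : (1 : ℝ) ≤ Fintype.card ι := by exact_mod_cast h
      exact div_nonneg (mul_nonneg (by linarith) (by linarith)) (by linarith)
  induction n with
  | zero => intro F _ _ d hd; exact ⟨d, by simpa using hd, by simp⟩
  | succ n ih =>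
    intro F hF hFb d hd
    obtain ⟨d', hd', hsum⟩ := ih hF hFb hd
    refine ⟨fun k => (Fintype.card ι : ℝ)⁻¹ * ∑ j, (if j = k then (0 : ℝ) else d' k + c * d' j),
      fun k X y y' => ?_, ?_⟩
    · rw [Function.iterate_succ_apply']
      exact osc_P hS hT hπ hZ hP hD (measurable_iterate_P hS hT hπ hP n hF)
        (abs_iterate_P_le hS hT hπ hZ hP n hF hFb) hd' k X y y'
    · rw [← Finset.mul_sum, sum_sum_ite_eq, pow_succ]
      calc (Fintype.card ι : ℝ)⁻¹ * (((Fintype.card ι : ℝ) - 1) * (1 + c) * ∑ k, d' k)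
          = ((Fintype.card ι : ℝ) - 1) * (1 + c) / (Fintype.card ι : ℝ) * ∑ k, d' k := by ring
        _ ≤ ((Fintype.card ι : ℝ) - 1) * (1 + c) / (Fintype.card ι : ℝ) *
            ((((Fintype.card ι : ℝ) - 1) * (1 + c) / (Fintype.card ι : ℝ)) ^ n * ∑ k, d k) :=
          mul_le_mul_of_nonneg_left hsum hρ
        _ = _ := by ring

end JastrowDobrushin

end Summit.AtomisticToContinuum.BoseEinsteinCondensation.Theorems
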